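import Literature.NumberTheory.Automorphic.LeviDetOneIndex
import Literature.NumberTheory.Automorphic.ParabolicInductionModulusProofs
import HarnessLib

/-!
# Generation of `GL_n` Jacquet modules by fixed vectors of bounded level

Let `π` be a smooth representation of `GL_n(F)` spanned by the translates of one vector `f₀`
(cyclic), and `r_d(π) = jacquetGL F d π` its (unnormalised) Jacquet module for a monotone
labelling `d : Fin n → Fin r`, a representation of the Levi `L = Π_a GL(B_a, F)`.

* `finite_asModule_jacquetGL_of_span_orbit_eq_top` — `r_d(π)` is finitely generated over `ℂ[L]`
  (the cyclic version of `finite_asModule_jacquetGL`; Bernstein–Zelevinsky 1977, Prop. 2.3);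
* `span_jacquetGL_fixedPoints_eq_top` — if `f₀ ∈ π^{K_γ}` (`K_γ` a principal congruence
  subgroup) then `r_d(π)` is spanned over `ℂ` by the `L`-translates of its vectors fixed by the
  Levi level `K^L_γ = {k : diag k ∈ K_γ}` (Iwasawa `G = P_d · GL_n(𝒪)` and normality of `K_γ` in
  `GL_n(𝒪)`): **the level of a cyclic representation controls the level generating its Jacquet
  module** (Bernstein–Zelevinsky 1976, 3.17; 1977, 2.3 and 3.13);
* `span_leviDetOne_jacquetGL_fixedPoints_eq_top` — the same over the subgroup `L°`, with the
  finitely many conjugates `l K^L_γ l⁻¹`, `l ∈ R`, of `LeviDetOneIndex` (`L = L° R Z(L)`).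

Theorems only.

## References

* I. N. Bernstein, A. V. Zelevinsky, *Induced representations of reductive `p`-adic groups I*,
  Ann. Sci. ÉNS 10 (1977), Prop. 2.3, 3.13.
* I. N. Bernstein, A. V. Zelevinsky, Russian Math. Surveys 31:3 (1976), 3.17.
-/

noncomputable section

open scoped MatrixGroups Pointwise

namespace Literature.NumberTheory.Automorphic

open Representation ValuativeRel

variable {F : Type*} [Field F] [ValuativeRel F] [TopologicalSpace F] [IsNonarchimedeanLocalField F]
  {n r : ℕ} {c : Fin n → Fin r} (hc : Monotone c) {V : Type*} [AddCommGroup V] [Module ℂ V]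
  (π : Representation ℂ (GL (Fin n) F) V)

include hc in
/-- **Jacquet modules of cyclic smooth representations are finitely generated** over the group
algebra of the Levi: if the translates `π(g) v₀` span `V` then, with `GL_n(F) = P_c · GL_n(𝒪)` and
finitely many cosets of `Stab(v₀)` in `GL_n(𝒪)`, finitely many classes `[π(s) v₀]` generate
`r_c(π)`. (The cyclic version of `finite_asModule_jacquetGL`.) [cite: BernsteinZelevinsky1977, Prop. 2.3] -/
theorem finite_asModule_jacquetGL_of_span_orbit_eq_top (hπ : π.IsSmooth) {v₀ : V}
    (hgen : Submodule.span ℂ (Set.range fun g : GL (Fin n) F => π g v₀) = ⊤) :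
    Module.Finite (MonoidAlgebra ℂ (Π a, GL {i // c i = a} F)) (jacquetGL F c π).asModule := by
  haveI : IsTopologicalRing F := inferInstance
  obtain ⟨t, ht⟩ := exists_finset_forall_inv_mul_mem (isCompact_glInt n F) (K := π.stabilizerSubgroup v₀) (hπ v₀)
  let gens : Set (restrictUnipotentGL F c π).Coinvariants :=
    (fun s : GL (Fin n) F => Coinvariants.mk (restrictUnipotentGL F c π) (π s v₀)) '' (t : Set (GL (Fin n) F))
  refine (jacquetGL F c π).finite_asModule_of_span_orbit_eq_top (s := gens) ((t.finite_toSet).image _) ?_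
  set S : Submodule ℂ (restrictUnipotentGL F c π).Coinvariants :=
    Submodule.span ℂ {w | ∃ m : (Π a, GL {i // c i = a} F), ∃ x ∈ gens, w = jacquetGL F c π m x} with hS
  have horb : ∀ g : GL (Fin n) F, Coinvariants.mk (restrictUnipotentGL F c π) (π g v₀) ∈ S := by
    intro g
    obtain ⟨p, hp, k₀, hk₀, rfl⟩ := exists_standardParabolicGL_mul_glInt F hc g
    obtain ⟨s, hs, hsk⟩ := ht k₀ hk₀
    have hk : π k₀ v₀ = π s v₀ := by
      have h1 : π (s⁻¹ * k₀) v₀ = v₀ := hsk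
      calc π k₀ v₀ = π s (π (s⁻¹ * k₀) v₀) := by rw [← Module.End.mul_apply, ← map_mul, mul_inv_cancel_left]
        _ = π s v₀ := by rw [h1]
    rw [map_mul, Module.End.mul_apply, hk, ← jacquetGL_leviProjection_mk F c π ⟨p, hp⟩ (π s v₀)]
    exact Submodule.subset_span ⟨_, _, ⟨s, hs, rfl⟩, rfl⟩
  -- the `[π(g) v₀]` span the coinvariants
  refine eq_top_iff.2 fun x _ => ?_
  obtain ⟨v, rfl⟩ := Coinvariants.mk_surjective _ x
  have hv : v ∈ Submodule.span ℂ (Set.range fun g : GL (Fin n) F => π g v₀) := by rw [hgen]; trivial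
  refine Submodule.span_induction (p := fun w _ => Coinvariants.mk (restrictUnipotentGL F c π) w ∈ S)
    ?_ ?_ ?_ ?_ hv
  · rintro _ ⟨g, rfl⟩
    exact horb g
  · rw [map_zero]; exact S.zero_mem
  · intro a b _ _ ha hb
    rw [map_add]; exact S.add_mem ha hb
  · intro a w _ hw
    rw [map_smul]; exact S.smul_mem a hw

include hc in
omit [TopologicalSpace F] [IsNonarchimedeanLocalField F] in
/-- **The level of a cyclic representation controls the level generating its Jacquet module.**
If `π` is smooth and spanned by the translates of `f₀ ∈ π^{K_γ}` (`K_γ = congruenceGL n γ`), then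
`r_c(π)` is spanned over `ℂ` by `{r_c(π)(l) z : l ∈ L, z ∈ r_c(π)^{K^L_γ}}`,
`K^L_γ = {k : diag k ∈ K_γ}`: with `g = p k₀` (`p ∈ P_c`, `k₀ ∈ GL_n(𝒪)`),
`[π(g) f₀] = r_c(π)(proj p) [π(k₀) f₀]` and `π(k₀) f₀ ∈ π^{K_γ}` (`K_γ ⊴ GL_n(𝒪)`), whose class is
`K^L_γ`-fixed. (Bernstein–Zelevinsky 1976, 3.17; 1977, 3.13.) [folklore] -/
theorem span_jacquetGL_fixedPoints_eq_top {γ : ValueGroupWithZero F} {f₀ : V}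
    (hf₀ : f₀ ∈ π.fixedPoints (congruenceGL n γ))
    (hgen : Submodule.span ℂ (Set.range fun g : GL (Fin n) F => π g f₀) = ⊤) :
    Submodule.span ℂ {x | ∃ l : (Π a, GL {i // c i = a} F),
      ∃ z ∈ (jacquetGL F c π).fixedPoints ((congruenceGL n γ).comap (blockDiagonalGL F c)),
        x = jacquetGL F c π l z} = ⊤ := by
  set S := Submodule.span ℂ {x | ∃ l : (Π a, GL {i // c i = a} F),
      ∃ z ∈ (jacquetGL F c π).fixedPoints ((congruenceGL n γ).comap (blockDiagonalGL F c)),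
        x = jacquetGL F c π l z} with hS
  -- classes of `K_γ`-fixed vectors are `K^L_γ`-fixed
  have hfix : ∀ w ∈ π.fixedPoints (congruenceGL n γ), Coinvariants.mk (restrictUnipotentGL F c π) w ∈
      (jacquetGL F c π).fixedPoints ((congruenceGL n γ).comap (blockDiagonalGL F c)) := by
    intro w hw
    rw [mem_fixedPoints] at hw ⊢
    intro k hk
    rw [jacquetGL_mk, hw _ (Subgroup.mem_comap.1 hk)]
  have horb : ∀ g : GL (Fin n) F, Coinvariants.mk (restrictUnipotentGL F c π) (π g f₀) ∈ S := by
    intro g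
    obtain ⟨p, hp, k₀, hk₀, rfl⟩ := exists_standardParabolicGL_mul_glInt F hc g
    -- `π(k₀) f₀` is `K_γ`-fixed
    have hk₀f : π k₀ f₀ ∈ π.fixedPoints (congruenceGL n γ) := by
      rw [mem_fixedPoints] at hf₀ ⊢
      intro k hk
      have hconj : k₀⁻¹ * k * k₀ ∈ congruenceGL n γ := by
        have := conj_mem_congruenceGL (Subgroup.inv_mem _ hk₀) hk
        rwa [inv_inv] at this
      calc π k (π k₀ f₀) = π k₀ (π (k₀⁻¹ * k * k₀) f₀) := by
            rw [← Module.End.mul_apply, ← Module.End.mul_apply, ← map_mul, ← map_mul, ← mul_assoc, ← mul_assoc,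
              mul_inv_cancel, one_mul]
        _ = π k₀ f₀ := by rw [hf₀ _ hconj]
    rw [map_mul, Module.End.mul_apply, ← jacquetGL_leviProjection_mk F c π ⟨p, hp⟩ (π k₀ f₀)]
    exact Submodule.subset_span ⟨_, _, hfix _ hk₀f, rfl⟩
  refine eq_top_iff.2 fun x _ => ?_
  obtain ⟨v, rfl⟩ := Coinvariants.mk_surjective _ x
  have hv : v ∈ Submodule.span ℂ (Set.range fun g : GL (Fin n) F => π g f₀) := by rw [hgen]; trivial
  refine Submodule.span_induction (p := fun w _ => Coinvariants.mk (restrictUnipotentGL F c π) w ∈ S)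
    ?_ ?_ ?_ ?_ hv
  · rintro _ ⟨g, rfl⟩
    exact horb g
  · rw [map_zero]; exact S.zero_mem
  · intro a b _ _ ha hb
    rw [map_add]; exact S.add_mem ha hb
  · intro a w _ hw
    rw [map_smul]; exact S.smul_mem a hw

/-- Central elements preserve fixed vectors: `Z(z) (V^K) ⊆ V^K` for `z ∈ Z(L)`. [folklore] -/
theorem apply_mem_fixedPoints_of_mem_center {L W : Type*} [Group L] [AddCommGroup W] [Module ℂ W]
    (Z : Representation ℂ L W) {K : Subgroup L} {z : L} (hz : z ∈ Subgroup.center L) {w : W}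
    (hw : w ∈ Z.fixedPoints K) : Z z w ∈ Z.fixedPoints K := by
  rw [mem_fixedPoints] at hw ⊢
  intro g hg
  rw [← Module.End.mul_apply, ← map_mul, Subgroup.mem_center_iff.1 hz g, map_mul, Module.End.mul_apply, hw g hg]

/-- Translates of fixed vectors are fixed by the conjugate subgroup: `Z(l) (V^K) ⊆ V^{l K l⁻¹}`. [folklore] -/
theorem apply_mem_fixedPoints_map_conj {L W : Type*} [Group L] [AddCommGroup W] [Module ℂ W]
    (Z : Representation ℂ L W) {K : Subgroup L} (l : L) {w : W} (hw : w ∈ Z.fixedPoints K) :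
    Z l w ∈ Z.fixedPoints (K.map (MulAut.conj l).toMonoidHom) := by
  rw [mem_fixedPoints] at hw ⊢
  rintro _ ⟨g, hg, rfl⟩
  rw [MulEquiv.coe_toMonoidHom, MulAut.conj_apply, ← Module.End.mul_apply, ← map_mul, mul_assoc, inv_mul_cancel, mul_one,
    map_mul, Module.End.mul_apply, hw g hg]

include hc in
/-- **Generation of the Jacquet module over `L°` by fixed vectors of finitely many conjugate
levels.** Under the hypotheses of `span_jacquetGL_fixedPoints_eq_top`, with `L = L° · R · Z(L)`
(`exists_finset_forall_eq_leviDetOne_mul_mul_center`): `r_c(π)` is spanned over `ℂ` by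
`{r_c(π)(h) z : h ∈ L°, z ∈ r_c(π)^{l K^L_γ l⁻¹}, l ∈ R}` (central elements preserve `K^L_γ`-fixed
vectors and `r_c(π)(l)` moves them to `l K^L_γ l⁻¹`-fixed vectors). [folklore] -/
theorem exists_finset_span_leviDetOne_jacquetGL_fixedPoints_eq_top {γ : ValueGroupWithZero F} {f₀ : V}
    (hf₀ : f₀ ∈ π.fixedPoints (congruenceGL n γ))
    (hgen : Submodule.span ℂ (Set.range fun g : GL (Fin n) F => π g f₀) = ⊤) :
    ∃ R : Finset (Π a, GL {i // c i = a} F),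
      Submodule.span ℂ {x | ∃ h ∈ leviDetOne F c, ∃ l : (R : Set (Π a, GL {i // c i = a} F)),
        ∃ z ∈ (jacquetGL F c π).fixedPoints
          (((congruenceGL n γ).comap (blockDiagonalGL F c)).map (MulAut.conj (l : Π a, GL {i // c i = a} F)).toMonoidHom),
        x = jacquetGL F c π h z} = ⊤ := by
  obtain ⟨R, hR⟩ := exists_finset_forall_eq_leviDetOne_mul_mul_center (F := F) c
  refine ⟨R, ?_⟩
  rw [eq_top_iff, ← span_jacquetGL_fixedPoints_eq_top hc π hf₀ hgen]
  refine Submodule.span_le.2 ?_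
  rintro _ ⟨l, z, hz, rfl⟩
  obtain ⟨h, hh, l', hl', zc, hzc, rfl⟩ := hR l
  rw [map_mul, map_mul, Module.End.mul_apply, Module.End.mul_apply]
  exact Submodule.subset_span ⟨h, hh, ⟨l', hl'⟩, _,
    apply_mem_fixedPoints_map_conj _ l' (apply_mem_fixedPoints_of_mem_center _ hzc hz), rfl⟩

end Literature.NumberTheory.Automorphic
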